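import Literature.Algebra.Lie.LefschetzTripleRepresentation
import Literature.Algebra.Lie.LefschetzModulePrimitive
import Literature.Algebra.Lie.WeylCompleteReducibility
import HarnessLib

/-!
# A representation of a Jordan–Lefschetz pair is generated as a `U𝔤₂`-module by its primitive subspace (Looijenga–Lunts 1997, (2.3))

Topic `Literature/Algebra/Lie` (namespace `Literature.Algebra.Lie`).  Lane `lit-hodgefound` (Track 2 foundations
library), skeleton seat `lit-hodgefound-skel-1` (generation 41), row **A1-108** of
`run/shared/lean/pub/lit-hodgefound/SKELETON.md`: Looijenga–Lunts (2.3) Corollary, for Jordan–Lefschetz pairs (A1-84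
`IsJordanLefschetzPair`), using A1-106 ("regard `M` as a Lefschetz module of `𝔤₂`":
`IsLefschetzTriple.isLefschetzModule_toEnd`, `lefschetzLieAlgebra_map_toEnd`) and A1-102 (`Prim(M)`:
`primSubmodule`, `IsLefschetzModule.primSubmodule_ne_bot`) and the tree's Weyl theorem
(`exists_isCompl_lieSubmodule_of_isSemisimple`).  PROVED theorems only (no definition, no named fact, no `sorry`;
D-0026 net debt `0`).  `LieRing.ofAssociativeRing` is enabled FILE-LOCALLY as in the rest of the series.

## Source, VERBATIM

E. Looijenga, V. A. Lunts, *A Lie algebra attached to a projective variety*, Invent. Math. **129** (1997) 361–412,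
§2 (held text `paper:arxiv-alg-geom_9604014` p0009 L108–L125; numbered rendering `paper:arxiv-alg-geom-9604014`
p0018 L22–L24, p0019 L1–L3):

> "Say that a Lefschetz pair `(𝔤, h)` is a Jordan–Lefschetz pair if `(𝔤, h, 𝔤₂)` is a Lefschetz triple. …
> (2.2) Proposition. If `(𝔤, h)` is a Jordan–Lefschetz pair, then `𝔤 = 𝔤₋₂ ⊕ 𝔤₀ ⊕ 𝔤₂` and
> `U𝔤 = U𝔤₂.U𝔤₀.U𝔤₋₂`.  Proof. If `e ∈ 𝔤₂` is a Lefschetz element, then `[e, 𝔤₂] = 0`. The first assertion now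
> follows from the primitive decomposition under `ad_e`. The second is a consequence of this.
> (2.3) Corollary. Let `(𝔤, h)` be a Jordan–Lefschetz pair and let `M` be a finite dimensional representation of
> `𝔤` and regard `M` as a Lefschetz module of `𝔤₂`. Then `M` is generated as a `U𝔤₂`-module by `Prim(M)`."

## Rendering (dictionary, continuing A1-84 / A1-102 / A1-106)

* `M` a finite-dimensional representation = Mathlib Lie module, `ρ = LieModule.toEnd K L M`; "regard `M` as a
  Lefschetz module of `𝔤₂`" = the Lefschetz module `(ρ 𝔤₂, M)` of A1-106, `IsLefschetzModule K (ρ h) (𝔤₂.map ρ)`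
  (for `ρ h ≠ 0`, i.e. `ρ ≠ 0`); `Prim(M)` = A1-102 `primSubmodule (ρ h) (𝔤₂.map ρ)` (vectors killed by
  `𝔤(ρ 𝔤₂, M)_{<0}`) — identified here with the joint kernel of `ρ(𝔤₋₂)` (`mem_primSubmodule_toEnd_iff`).
* "`M` is generated as a `U𝔤₂`-module by `Prim(M)`" = every `K`-subspace `N ⊆ M` containing `Prim(M)` and stable
  under `ρ(𝔤₂)` is `M` (`𝔤₂` is abelian, so `U𝔤₂ · Prim(M)` is the smallest such subspace).  The intrinsic form
  `eq_top_of_forall_mem_of_forall_lie_mem` (primitive := killed by `ρ(𝔤₋₂)`) needs no `ρ ≠ 0`.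

## Contents (all proved)

* §1 `IsJordanLefschetzPair.lie_eq_zero_of_mem_primSubmodule`, `….mem_primSubmodule_of_forall_lie_eq_zero`,
  **`IsJordanLefschetzPair.mem_primSubmodule_toEnd_iff`** (`Prim(M) = {m | ρ(𝔤₋₂) m = 0}`, from A1-106
  `𝔤(ρ 𝔤₂, M) = ρ(𝔤)`, A1-84 `𝔤 = 𝔤₋₂ ⊕ 𝔤₀ ⊕ 𝔤₂` and the independence of the eigenspaces of `ad ρ(h)`).
* §2 **`IsJordanLefschetzPair.exists_mem_ne_zero_forall_lie_eq_zero`**: a sub-representation `W ≠ 0` contains a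
  non-zero vector killed by `𝔤₋₂` (A1-106 + A1-102 `Prim ≠ 0`, or `ρ_W = 0`).
* §3 **`IsJordanLefschetzPair.eq_top_of_forall_mem_of_forall_lie_mem`** (intrinsic (2.3)) and
  **`IsJordanLefschetzPair.eq_top_of_primSubmodule_le`** ((2.3) as printed, on A1-102's `Prim`).

## Proof of (2.3) given here (the source: "a consequence of" `U𝔤 = U𝔤₂.U𝔤₀.U𝔤₋₂`)

The smallest subspace `N₀ ⊇ Prim(M)` stable under `𝔤₂` is `𝔤₀`-stable (the subspace of `m ∈ N₀` with `𝔤₀ m ⊆ N₀`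
contains `Prim(M)` because `[𝔤₋₂, 𝔤₀] ⊆ 𝔤₋₂` keeps primitive vectors primitive, and is `𝔤₂`-stable because
`[𝔤₀, 𝔤₂] ⊆ 𝔤₂`), then `𝔤₋₂`-stable (same pattern with `[𝔤₋₂, 𝔤₂] ⊆ 𝔤₀`), hence a sub-representation
(`𝔤 = 𝔤₋₂ ⊕ 𝔤₀ ⊕ 𝔤₂`).  By Weyl it has a `𝔤`-stable complement `W`; if `W ≠ 0` it contains a non-zero vector
killed by `𝔤₋₂` (§2), which is in `N₀ ∩ W = 0` — contradiction.  This is the straightening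
`U𝔤 · Prim = U𝔤₂ U𝔤₀ U𝔤₋₂ · Prim = U𝔤₂ · Prim` of the source, carried out on subspaces.

## SCOPE (what is NOT formalised here)

(a) (2.2)'s second assertion `U𝔤 = U𝔤₂.U𝔤₀.U𝔤₋₂` as a statement about the universal enveloping algebra is not
formalised (Mathlib's `UniversalEnvelopingAlgebra` has no PBW-type API); only its consequence (2.3) is.  (b) The
first assertion of (2.2) is A1-84 (`IsJordanLefschetzPair.sup_adDegree_eq_top`, `adDegree_eq_bot`).  (c) Nothing
here concerns complex tori or the Hodge conjecture.

## References

* [LooijengaLunts1997] E. Looijenga, V. A. Lunts, *A Lie algebra attached to a projective variety*, Invent. Math. 129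
  (1997) 361–412; arXiv:alg-geom/9604014. §2 (2.2)–(2.3), p. 9 L108–L125 of the held text; §1 (1.13) p. 7 L42–L45.
-/

namespace Literature.Algebra.Lie

open Module Function Set LieModule LieAlgebra

-- The commutator Lie ring of `𝔤𝔩(M) = Module.End K M`: Mathlib's reducible NON-instance, enabled file-locally
-- exactly as in `LefschetzModule.lean`.
attribute [local instance 100] LieRing.ofAssociativeRing

section JordanPrim

variable {K : Type*} [Field K] [CharZero K] {L : Type*} [LieRing L] [LieAlgebra K L] [FiniteDimensional K L]
  {M : Type*} [AddCommGroup M] [Module K M] [FiniteDimensional K M] [LieRingModule L M] [LieModule K L M]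
  {h : L}

omit [FiniteDimensional K L] [FiniteDimensional K M] [CharZero K] in
/-- `ρ` maps `𝔤_c` into `𝔤𝔩(M)_c` (the `c`-eigenspace of `ad ρ(h)`). [folklore] -/
private theorem toEnd_mem_adDegree {c : K} {t : L} (ht : t ∈ adDegree K h c) :
    toEnd K L M t ∈ adDegree K (toEnd K L M h) c := by
  rw [mem_adDegree_iff]
  show ⁅toEnd K L M h, toEnd K L M t⁆ = c • toEnd K L M t
  rw [← LieHom.map_lie, mem_adDegree_iff.1 ht, map_smul]

/-! ## §1 "regard `M` as a Lefschetz module of `𝔤₂`": its primitive subspace is the joint kernel of `𝔤₋₂` -/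

/-- For a Jordan–Lefschetz pair `(𝔤, h)` and a representation `ρ ≠ 0` of `𝔤` on `M`, regarded as the Lefschetz module
`(ρ 𝔤₂, M)` (A1-106), a primitive vector (A1-102: killed by `𝔤(ρ 𝔤₂, M)_{<0}`) is killed by `ρ(𝔤₋₂)`.
[cite: LooijengaLunts1997, §2 (2.3) p. 9 L121–L125; §1 (1.13) p. 7 L42–L44] -/
theorem IsJordanLefschetzPair.lie_eq_zero_of_mem_primSubmodule (J : IsJordanLefschetzPair K h)
    (h0 : toEnd K L M h ≠ 0) {m : M}
    (hm : m ∈ primSubmodule (toEnd K L M h) ((adDegree K h 2).map (toEnd K L M : L →ₗ[K] Module.End K M)))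
    {y : L} (hy : y ∈ adDegree K h (-2)) : ⁅y, m⁆ = 0 := by
  have h1 : toEnd K L M y ∈
      lefschetzLieAlgebra K (toEnd K L M h) ((adDegree K h 2).map (toEnd K L M : L →ₗ[K] Module.End K M)) := by
    rw [J.isLefschetzTriple.lefschetzLieAlgebra_map_toEnd h0]
    exact LieHom.mem_range_self _ y
  have h2 : toEnd K L M y ∈ adDegree K (toEnd K L M h) (-((2 : ℕ) : K)) := by
    rw [Nat.cast_ofNat]
    exact toEnd_mem_adDegree hy
  exact (mem_primSubmodule_iff.1 hm) _ h1 2 two_pos h2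

/-- Conversely a vector killed by `ρ(𝔤₋₂)` is primitive: `𝔤(ρ 𝔤₂, M)_{<0} = ρ(𝔤)_{<0} = ρ(𝔤₋₂)` modulo elements acting
as `0`, because `𝔤 = 𝔤₋₂ ⊕ 𝔤₀ ⊕ 𝔤₂` (A1-84 (2.2)) and the eigenspaces of `ad ρ(h)` are independent.
[cite: LooijengaLunts1997, §2 (2.3) p. 9 L121–L125; (2.2) p. 9 L112–L114] -/
theorem IsJordanLefschetzPair.mem_primSubmodule_of_forall_lie_eq_zero (J : IsJordanLefschetzPair K h)
    (h0 : toEnd K L M h ≠ 0) {m : M} (hm : ∀ y ∈ adDegree K h (-2), ⁅y, m⁆ = 0) :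
    m ∈ primSubmodule (toEnd K L M h) ((adDegree K h 2).map (toEnd K L M : L →ₗ[K] Module.End K M)) := by
  rw [mem_primSubmodule_iff]
  intro x hx n hn hxn
  rw [J.isLefschetzTriple.lefschetzLieAlgebra_map_toEnd h0] at hx
  obtain ⟨z, rfl⟩ := (LieHom.mem_range _ _).1 hx
  obtain ⟨u, hu, v, hv, w, hw, rfl⟩ := J.exists_eq_add z
  have hum : toEnd K L M u m = 0 := hm u hu
  by_cases h2 : (n : K) = 2
  · -- `ρ v + ρ w ∈ 𝔤𝔩_{-2} ∩ (𝔤𝔩_0 + 𝔤𝔩_2) = 0`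
    have h3 : toEnd K L M v + toEnd K L M w ∈ adDegree K (toEnd K L M h) (-2) := by
      rw [h2] at hxn
      have h4 := sub_mem hxn (toEnd_mem_adDegree (M := M) hu)
      rwa [map_add, map_add, add_assoc, add_sub_cancel_left] at h4
    have h5 : toEnd K L M v + toEnd K L M w ∈ ⨆ b : Bool, adDegree K (toEnd K L M h) (cond b 0 2 : K) :=
      add_mem (Submodule.mem_iSup_of_mem true (toEnd_mem_adDegree hv))
        (Submodule.mem_iSup_of_mem false (toEnd_mem_adDegree hw))
    have h6 : Disjoint (adDegree K (toEnd K L M h) (-2)) (⨆ b : Bool, adDegree K (toEnd K L M h) (cond b 0 2 : K)) :=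
      disjoint_adDegree_iSup _ (by rintro (_ | _) <;> norm_num)
    have h7 : toEnd K L M v + toEnd K L M w = 0 := (Submodule.disjoint_def.1 h6) _ h3 h5
    rw [map_add, map_add, add_assoc, h7, add_zero]
    exact hum
  · -- `x ∈ 𝔤𝔩_{-n} ∩ (𝔤𝔩_{-2} + 𝔤𝔩_0 + 𝔤𝔩_2) = 0`
    have h5 : toEnd K L M (u + v + w) ∈ ⨆ i : Fin 3, adDegree K (toEnd K L M h) ((![-2, 0, 2] : Fin 3 → K) i) := by
      rw [map_add, map_add]
      exact add_mem (add_mem (Submodule.mem_iSup_of_mem 0 (toEnd_mem_adDegree hu))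
        (Submodule.mem_iSup_of_mem 1 (toEnd_mem_adDegree hv))) (Submodule.mem_iSup_of_mem 2 (toEnd_mem_adDegree hw))
    have h6 : Disjoint (adDegree K (toEnd K L M h) (-(n : K)))
        (⨆ i : Fin 3, adDegree K (toEnd K L M h) ((![-2, 0, 2] : Fin 3 → K) i)) := by
      refine disjoint_adDegree_iSup _ fun i ↦ ?_
      fin_cases i
      · show (-2 : K) ≠ -(n : K)
        exact fun h7 ↦ h2 (neg_inj.1 h7).symm
      · show (0 : K) ≠ -(n : K)
        intro h7
        exact absurd (Nat.cast_eq_zero.1 (neg_eq_zero.1 h7.symm)) hn.ne'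
      · show (2 : K) ≠ -(n : K)
        intro h7
        have h8 : ((n + 2 : ℕ) : K) = 0 := by rw [Nat.cast_add, Nat.cast_two, h7, add_neg_cancel]
        exact absurd (Nat.cast_eq_zero.1 h8) (by omega)
    have h7 : toEnd K L M (u + v + w) = 0 := (Submodule.disjoint_def.1 h6) _ hxn h5
    rw [h7, LinearMap.zero_apply]

/-- **The primitive subspace of a representation of a Jordan–Lefschetz pair** — "regard `M` as a Lefschetz module of
`𝔤₂`" (A1-106): `Prim(M)` (A1-102 `primSubmodule`) is the joint kernel of `ρ(𝔤₋₂)`.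
[cite: LooijengaLunts1997, §2 (2.3) p. 9 L121–L125; §1 (1.13) p. 7 L42–L44] -/
theorem IsJordanLefschetzPair.mem_primSubmodule_toEnd_iff (J : IsJordanLefschetzPair K h) (h0 : toEnd K L M h ≠ 0)
    {m : M} : m ∈ primSubmodule (toEnd K L M h) ((adDegree K h 2).map (toEnd K L M : L →ₗ[K] Module.End K M)) ↔
      ∀ y ∈ adDegree K h (-2), ⁅y, m⁆ = 0 :=
  ⟨fun hm _ hy ↦ J.lie_eq_zero_of_mem_primSubmodule h0 hm hy, J.mem_primSubmodule_of_forall_lie_eq_zero h0⟩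

/-! ## §2 Every `𝔤`-stable subspace `W ≠ 0` contains a non-zero vector killed by `𝔤₋₂` -/

/-- A non-zero sub-representation `W` of a representation of a Jordan–Lefschetz pair contains a non-zero vector killed
by `𝔤₋₂`: if `ρ_W(h) = 0` then `ρ_W = 0` (A1-106) and any `w ≠ 0` works; otherwise `(ρ_W 𝔤₂, W)` is a Lefschetz module
(A1-106) and `Prim(W) ≠ 0` (A1-102 (1.13) "Since `𝔤(𝔞, M)_{<0}` is nilpotent, `Prim(M) ≠ 0`").
[cite: LooijengaLunts1997, §1 (1.13) p. 7 L44–L45; §2 (2.3) p. 9 L121–L125] -/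
theorem IsJordanLefschetzPair.exists_mem_ne_zero_forall_lie_eq_zero (J : IsJordanLefschetzPair K h)
    (W : LieSubmodule K L M) (hW : W ≠ ⊥) :
    ∃ v ∈ W, v ≠ 0 ∧ ∀ y ∈ adDegree K h (-2), ⁅y, v⁆ = 0 := by
  haveI : Nontrivial W := by
    obtain ⟨v, hv, hv0⟩ := (Submodule.ne_bot_iff (W : Submodule K M)).1 (by rwa [Ne, LieSubmodule.toSubmodule_eq_bot])
    exact ⟨⟨⟨v, hv⟩, 0, fun h1 ↦ hv0 (congrArg Subtype.val h1)⟩⟩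
  haveI : FiniteDimensional K W := inferInstanceAs (FiniteDimensional K (W : Submodule K M))
  by_cases hW0 : toEnd K L W h = 0
  · have h1 := J.isLefschetzTriple.toEnd_eq_zero_of_toEnd_h_eq_zero (M := W) hW0
    obtain ⟨v, hv0⟩ := exists_ne (0 : W)
    refine ⟨v, v.2, fun h2 ↦ hv0 (Subtype.ext h2), fun y _ ↦ ?_⟩
    have h3 : ⁅y, v⁆ = 0 := by
      rw [← toEnd_apply_apply K, h1, LieHom.zero_apply, LinearMap.zero_apply]
    have h4 := congrArg Subtype.val h3
    rwa [LieSubmodule.coe_bracket] at h4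
  · have A := J.isLefschetzTriple.isLefschetzModule_toEnd (M := W) hW0
    obtain ⟨v, hv, hv0⟩ := (Submodule.ne_bot_iff _).1 A.primSubmodule_ne_bot
    refine ⟨v, v.2, fun h2 ↦ hv0 (Subtype.ext h2), fun y hy ↦ ?_⟩
    have h3 : ⁅y, v⁆ = 0 := J.lie_eq_zero_of_mem_primSubmodule hW0 hv hy
    have h4 := congrArg Subtype.val h3
    rwa [LieSubmodule.coe_bracket] at h4

/-! ## §3 (2.3) Corollary: `M` is generated as a `U𝔤₂`-module by `Prim(M)` -/

/-- **(2.3) Corollary, intrinsic form.** For a Jordan–Lefschetz pair `(𝔤, h)` (A1-84) and a finite-dimensional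
representation `M` of `𝔤`: every subspace `N ⊆ M` that contains all vectors killed by `𝔤₋₂` and is stable under
`𝔤₂` is all of `M` — i.e. `M = U𝔤₂ · Prim(M)`.  Proof (the source: "a consequence of" (2.2)
`U𝔤 = U𝔤₂.U𝔤₀.U𝔤₋₂`, done here by hand): the smallest such subspace `N₀` is `𝔤₀`-stable (`[𝔤₋₂, 𝔤₀] ⊆ 𝔤₋₂` keeps
primitive vectors primitive, `[𝔤₀, 𝔤₂] ⊆ 𝔤₂`), then `𝔤₋₂`-stable (`[𝔤₋₂, 𝔤₂] ⊆ 𝔤₀`), hence — `𝔤 = 𝔤₋₂ ⊕ 𝔤₀ ⊕ 𝔤₂`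
— a sub-representation; a `𝔤`-stable complement (Weyl) would contain a non-zero vector killed by `𝔤₋₂` (§2),
which lies in `N₀`: so the complement is `0`. [cite: LooijengaLunts1997, §2 (2.3) p. 9 L121–L125] -/
theorem IsJordanLefschetzPair.eq_top_of_forall_mem_of_forall_lie_mem (J : IsJordanLefschetzPair K h)
    {N : Submodule K M} (hP : ∀ m : M, (∀ y ∈ adDegree K h (-2), ⁅y, m⁆ = 0) → m ∈ N)
    (hN : ∀ a ∈ adDegree K h 2, ∀ m ∈ N, ⁅a, m⁆ ∈ N) : N = ⊤ := by
  -- the smallest subspace containing the primitive vectors and stable under `𝔤₂`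
  let F : Set (Submodule K M) :=
    {N' | (∀ m : M, (∀ y ∈ adDegree K h (-2), ⁅y, m⁆ = 0) → m ∈ N') ∧ ∀ a ∈ adDegree K h 2, ∀ m ∈ N', ⁅a, m⁆ ∈ N'}
  let N₀ : Submodule K M := sInf F
  have hF0 : N₀ ∈ F := by
    refine ⟨fun m hm ↦ Submodule.mem_sInf.2 fun N' hN' ↦ hN'.1 m hm, fun a ha m hm ↦ ?_⟩
    exact Submodule.mem_sInf.2 fun N' hN' ↦ hN'.2 a ha m (Submodule.mem_sInf.1 hm N' hN')
  have hle : N₀ ≤ N := sInf_le ⟨hP, hN⟩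
  -- `𝔤₀`-stability
  have h0st : ∀ x ∈ adDegree K h 0, ∀ m ∈ N₀, ⁅x, m⁆ ∈ N₀ := by
    let N₁ : Submodule K M :=
      { carrier := {m | m ∈ N₀ ∧ ∀ x ∈ adDegree K h 0, ⁅x, m⁆ ∈ N₀}
        add_mem' := fun {m m'} hm hm' ↦ ⟨add_mem hm.1 hm'.1, fun x hx ↦ by
          rw [lie_add]; exact add_mem (hm.2 x hx) (hm'.2 x hx)⟩
        zero_mem' := ⟨zero_mem _, fun x _ ↦ by rw [lie_zero]; exact zero_mem _⟩
        smul_mem' := fun c {m} hm ↦ ⟨Submodule.smul_mem _ c hm.1, fun x hx ↦ by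
          rw [lie_smul]; exact Submodule.smul_mem _ c (hm.2 x hx)⟩ }
    have h1 : N₁ ∈ F := by
      refine ⟨fun m hm ↦ ⟨hF0.1 m hm, fun x hx ↦ hF0.1 _ fun y hy ↦ ?_⟩, fun a ha m hm ↦ ⟨hF0.2 a ha m hm.1, fun x hx ↦ ?_⟩⟩
      · have h2 := lie_mem_adDegree hy hx
        rw [show (-2 : K) + 0 = -2 by norm_num] at h2
        rw [leibniz_lie, hm _ h2, hm y hy, lie_zero, add_zero]
      · have h2 := lie_mem_adDegree hx ha
        rw [show (0 : K) + 2 = 2 by norm_num] at h2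
        rw [leibniz_lie]
        exact add_mem (hF0.2 _ h2 m hm.1) (hF0.2 a ha _ (hm.2 x hx))
    intro x hx m hm
    exact ((sInf_le h1 : N₀ ≤ N₁) hm).2 x hx
  -- `𝔤₋₂`-stability
  have hnst : ∀ y ∈ adDegree K h (-2), ∀ m ∈ N₀, ⁅y, m⁆ ∈ N₀ := by
    let N₂ : Submodule K M :=
      { carrier := {m | m ∈ N₀ ∧ ∀ y ∈ adDegree K h (-2), ⁅y, m⁆ ∈ N₀}
        add_mem' := fun {m m'} hm hm' ↦ ⟨add_mem hm.1 hm'.1, fun x hx ↦ by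
          rw [lie_add]; exact add_mem (hm.2 x hx) (hm'.2 x hx)⟩
        zero_mem' := ⟨zero_mem _, fun x _ ↦ by rw [lie_zero]; exact zero_mem _⟩
        smul_mem' := fun c {m} hm ↦ ⟨Submodule.smul_mem _ c hm.1, fun x hx ↦ by
          rw [lie_smul]; exact Submodule.smul_mem _ c (hm.2 x hx)⟩ }
    have h1 : N₂ ∈ F := by
      refine ⟨fun m hm ↦ ⟨hF0.1 m hm, fun y hy ↦ by rw [hm y hy]; exact zero_mem _⟩,
        fun a ha m hm ↦ ⟨hF0.2 a ha m hm.1, fun y hy ↦ ?_⟩⟩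
      have h2 := lie_mem_adDegree hy ha
      rw [show (-2 : K) + 2 = 0 by norm_num] at h2
      rw [leibniz_lie]
      exact add_mem (h0st _ h2 m hm.1) (hF0.2 a ha _ (hm.2 y hy))
    intro y hy m hm
    exact ((sInf_le h1 : N₀ ≤ N₂) hm).2 y hy
  -- so `N₀` is a sub-representation
  have hst : ∀ (x : L), ∀ m ∈ N₀, ⁅x, m⁆ ∈ N₀ := by
    intro x m hm
    obtain ⟨u, hu, v, hv, w, hw, rfl⟩ := J.exists_eq_add x
    rw [add_lie, add_lie]
    exact add_mem (add_mem (hnst u hu m hm) (h0st v hv m hm)) (hF0.2 w hw m hm)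
  let N₀L : LieSubmodule K L M := { N₀ with lie_mem := fun {x} {m} hm ↦ hst x m hm }
  -- Weyl: a `𝔤`-stable complement, which must vanish
  haveI := J.isLefschetzTriple.isSemisimple
  obtain ⟨W, hW⟩ := exists_isCompl_lieSubmodule_of_isSemisimple N₀L
  have hWbot : W = ⊥ := by
    by_contra hne
    obtain ⟨v, hvW, hv0, hv⟩ := J.exists_mem_ne_zero_forall_lie_eq_zero W hne
    have h1 : v ∈ N₀L := hF0.1 v hv
    have h2 : v ∈ N₀L ⊓ W := (LieSubmodule.mem_inf _ _ _).2 ⟨h1, hvW⟩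
    rw [hW.inf_eq_bot, LieSubmodule.mem_bot] at h2
    exact hv0 h2
  have htop : N₀L = ⊤ := by
    have h1 := hW.sup_eq_top
    rwa [hWbot, sup_bot_eq] at h1
  have htop' : N₀ = ⊤ := by
    have h1 := congrArg LieSubmodule.toSubmodule htop
    rw [LieSubmodule.top_toSubmodule] at h1
    exact h1
  exact eq_top_iff.2 (htop' ▸ hle)

/-- **(2.3) Corollary** ("Let `(𝔤, h)` be a Jordan–Lefschetz pair and let `M` be a finite dimensional representation
of `𝔤` and regard `M` as a Lefschetz module of `𝔤₂`. Then `M` is generated as a `U𝔤₂`-module by `Prim(M)`."), with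
`Prim(M)` the primitive subspace (A1-102 `primSubmodule`) of the Lefschetz module `(ρ 𝔤₂, M)` of A1-106
(`ρ h ≠ 0`, i.e. `ρ ≠ 0`): every `𝔤₂`-stable subspace containing `Prim(M)` is `M`.
[cite: LooijengaLunts1997, §2 (2.3) p. 9 L121–L125] -/
theorem IsJordanLefschetzPair.eq_top_of_primSubmodule_le (J : IsJordanLefschetzPair K h) (h0 : toEnd K L M h ≠ 0)
    {N : Submodule K M}
    (hP : primSubmodule (toEnd K L M h) ((adDegree K h 2).map (toEnd K L M : L →ₗ[K] Module.End K M)) ≤ N)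
    (hN : ∀ a ∈ adDegree K h 2, ∀ m ∈ N, ⁅a, m⁆ ∈ N) : N = ⊤ :=
  J.eq_top_of_forall_mem_of_forall_lie_mem (fun _ hm ↦ hP (J.mem_primSubmodule_of_forall_lie_eq_zero h0 hm)) hN

end JordanPrim

end Literature.Algebra.Lie
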